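/- Copyright: the b2b-balaban cell (near-miss cell 7), T⁴-continuum fan-out, lineage t4-ne7b-p1 (node U5c COUNT
member).  Released under the licence of the surrounding project. -/
import Summits.QuantumFields.BalabanUV.T4Continuum.Support.HistoryGenealogyExtraction
import Summits.QuantumFields.BalabanUV.T4Continuum.Support.HistoryRealise

/-!
# Genealogy REALISATION, part 1 of 2 (H3-(ID), geometric half M3b-1): JOIN CHAINS REALISED — print's maximal-tree
binarisation `joinTail`∕`assemble` of row S13 over row S1b's `HistoryRealise.Realises` (owner module of row NE7b,
lineage `t4-ne7b-p1` gen 40, ruling R-OWNER-40-1; re-open object (α) of `WALL-NE7b-P1.md` §4 (i)∕(v), `SCOPE-alpha.md`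
v2 §5 row M3b — PRE-POSITIONING ONLY; sibling `…HistoryGenealogyRealise` carries the data, the displayed clauses and
the realisation theorem)

Summits-side support leaf of the T⁴-continuum cell (rung (B)+1 on a FINITE torus only; NOT infinite volume, NOT the
mass gap, NOT the Clay statement; NOT a proof of the spine estimate NE7b, which is the cell's OWN estimate, NOT PRINTED
and NOT PROVED).  [folklore] finite combinatorics in the ℤᵈ index model over row S13's `joinTail`∕`assemble`
(`HistoryGenealogyExtraction`, p244684) and row S1b's `Realises`∕`PendingAt`∕`orbit` (`HistoryRealise`, p209120);
nothing printed is asserted, no `def … : Prop` fact of Bałaban's, no cite-tagged hypothesis, zero `sorry`.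
B16 = [Balaban1989LargeFieldII] p. 386 is a manuscript UNDER AUDIT; the sentence quoted below only LOCATES the printed
step the list order transcribes (certified reading C-B16-6, `t4/T4-XREAD-NE7b-READING.md` V3∕D3).

WHY.  Row S13's extraction assembles a component with ≥ 2 constituents as the right-nested binary join chain
`joinTail T [U₁, …, U_m] s` in the LISTED order of the constituents («Let us take a maximal tree graph contained in the
graph G … an endpoint X … the rest Y», p. 386), and row S1b's `Realises (join X Y s) Z` asks: both partners realised and
PENDING at `s`, their current images TOUCHING, `Z` inside the union of the images ((1.84)).  This file proves the list
form once: the order must be LEAF-FIRST — each constituent's image touches the union of the LATER images (`ChainTouch`)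
— and then the whole chain is realised by any domain inside the union of all images (the rest of the chain is realised
by the union of its own images and is trivially pending at its own step).  BY-NAME EFFECT ON THE WALL: NONE
(pre-positioning for (α)).

WHAT IS DEFINED AND PROVED.  `Lab d = Pt d × Finset (Pt d)` (row S1b's label payload: anchor cube, region); `unionL`
(union of a list of domains; `mem_unionL`, `subset_unionL`); **`ChainTouch`** (each domain touches the union of the
later ones); **`img L s sj (U, Z)`** (the current image at `sj` of a line with history `U` and last-event domain `Z`:
`orbit` from `U.lastStep`); `pendingAt_self` (no stop has index `0`); **`realises_joinTail`** (head + nonempty tail of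
(history, domain) pairs, each realised with `lastStep ≤ sj` and pending at `sj`, images in `ChainTouch` order, `Z`
inside the union ⟹ `Realises (joinTail T (tail histories) sj) Z`); **`realises_assemble_of_two_le`** (print's
trichotomy, join branch: ≥ 2 constituents ⟹ the assembled genealogy at `sj` is realised by any such `Z` and has last
step `sj`).  §1b two helpers for the sibling (`orbit_level_succ`: one more orbit step read at an absolute level is ONE
S-operation with the level's ratio; sum-typed lists with no left entry).  §1c SANITY in `ℤ¹`: two touching unit regions
born at step `0` and joined at step `0` are realised by their union (an instance of `realises_joinTail`).

HONEST.  Proves nothing of Bałaban's; NE7b NOT proved; spine 0∕9.  HONEST DEPENDENCY (cell): continuum YM on T⁴ ⇐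
BetaPertH ∧ nine spine estimates (0/9 proved); BetaPertH ⇐ (D1) ∧ (D4) ∧ CAP+tail; G-an2-4 gates asym, D1 and NE2/3/4.
This file changes none of it. -/

open Finset
open Literature.MathematicalPhysics.QuantumFieldTheory.Balaban1983to89
open Literature.MathematicalPhysics.QuantumFieldTheory.Balaban1983to89.B13ScaleTransfer
open Literature.MathematicalPhysics.QuantumFieldTheory.Balaban1983to89.TreeLength
open Literature.MathematicalPhysics.QuantumFieldTheory.Balaban1983to89.B16SProfile
open Literature.MathematicalPhysics.QuantumFieldTheory.Balaban1983to89.B16MergeGeometry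
open Summit.QuantumFields.BalabanUV.T4Continuum.HistoryAdmissible
open Summit.QuantumFields.BalabanUV.T4Continuum.HistoryAdmissible.PGen
open Summit.QuantumFields.BalabanUV.T4Continuum.HistoryRealise
open Summit.QuantumFields.BalabanUV.T4Continuum.HistoryGenealogyExtraction

namespace Summit.QuantumFields.BalabanUV.T4Continuum.HistoryGenealogyRealise

noncomputable section

variable {d : ℕ}

/-- the label type of row S1b: (anchor cube, region) [folklore] -/
abbrev Lab (d : ℕ) := Pt d × Finset (Pt d)

/-! ## §1 Join chains realised -/

/-- the union of a list of domains [folklore] -/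
def unionL : List (Finset (Pt d)) → Finset (Pt d)
  | [] => ∅
  | A :: L => A ∪ unionL L

/-- `unionL` of the empty list [folklore] -/
@[simp] theorem unionL_nil : unionL ([] : List (Finset (Pt d))) = ∅ := rfl

/-- `unionL` of a cons [folklore] -/
@[simp] theorem unionL_cons (A : Finset (Pt d)) (L : List (Finset (Pt d))) : unionL (A :: L) = A ∪ unionL L := rfl

/-- membership in `unionL` [folklore] -/
theorem mem_unionL {x : Pt d} : ∀ {L : List (Finset (Pt d))}, x ∈ unionL L ↔ ∃ A ∈ L, x ∈ A
  | [] => by simp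
  | A :: L => by simp [mem_unionL (L := L)]

/-- a member domain lies in the union [folklore] -/
theorem subset_unionL {A : Finset (Pt d)} {L : List (Finset (Pt d))} (h : A ∈ L) : A ⊆ unionL L :=
  fun _ hx => mem_unionL.2 ⟨A, h, hx⟩

/-- **`ChainTouch`**: each domain of the list touches the union of the LATER ones (the leaf-first order along print's
maximal tree, p. 386: the endpoint `X` touches the rest `Y`, recursively). [folklore] -/
def ChainTouch : List (Finset (Pt d)) → Prop
  | [] => True
  | [_] => True
  | A :: B :: L => (∃ a ∈ A, ∃ c ∈ unionL (B :: L), Touch a c) ∧ ChainTouch (B :: L)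

/-- `ChainTouch` of at least two domains, unfolded [folklore] -/
@[simp] theorem chainTouch_cons_cons (A B : Finset (Pt d)) (L : List (Finset (Pt d))) :
    ChainTouch (A :: B :: L) ↔ (∃ a ∈ A, ∃ c ∈ unionL (B :: L), Touch a c) ∧ ChainTouch (B :: L) := Iff.rfl

/-- `ChainTouch` of one domain holds [folklore] -/
@[simp] theorem chainTouch_singleton (A : Finset (Pt d)) : ChainTouch [A] := trivial

/-- `ChainTouch` of no domain holds [folklore] -/
@[simp] theorem chainTouch_nil : ChainTouch ([] : List (Finset (Pt d))) := trivial

/-- **THE CURRENT IMAGE AT STEP `sj`** of a line with history `U` and last-event domain `Z`: the orbit of `Z` from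
`U.lastStep`, `sj − U.lastStep` steps on. [folklore] -/
def img (L : ℕ) (s : ℕ → ℕ) (sj : ℕ) (UZ : PGen (Lab d) × Finset (Pt d)) : Finset (Pt d) :=
  orbit L s UZ.1.lastStep UZ.2 (sj - UZ.1.lastStep)

/-- the image of a line at its own last step is its last-event domain [folklore] -/
theorem img_of_lastStep_eq (L : ℕ) (s : ℕ → ℕ) {sj : ℕ} {UZ : PGen (Lab d) × Finset (Pt d)}
    (h : UZ.1.lastStep = sj) : img L s sj UZ = UZ.2 := by
  simp [img, h]

/-- a line is (trivially) pending at its own last step: no stop has index `0` [folklore] -/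
theorem pendingAt_self (L : ℕ) (s R : ℕ → ℕ) (t : ℕ) (Z : Finset (Pt d)) : PendingAt L s R t Z t :=
  ⟨le_rfl, fun k hk hS => by have := hS.pos; omega⟩

section JoinChain

variable {L : ℕ} {s R : ℕ → ℕ}

/-- **JOIN CHAINS REALISED.**  Head `T` realised by `ZT` and further constituents `Us` (each realised by its listed
domain), all with `lastStep ≤ sj` and PENDING at `sj`, listed so that each image touches the union of the later images,
and a domain `Z` inside the union of all images ⟹ `Realises (joinTail T (Us.map Prod.fst) sj) Z`. [folklore] -/
theorem realises_joinTail (sj : ℕ) :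
    ∀ (T : PGen (Lab d)) (ZT : Finset (Pt d)) (Us : List (PGen (Lab d) × Finset (Pt d))), Us ≠ [] →
      Realises L s R T ZT → T.lastStep ≤ sj → PendingAt L s R T.lastStep ZT sj →
      (∀ UZ ∈ Us, Realises L s R UZ.1 UZ.2 ∧ UZ.1.lastStep ≤ sj ∧ PendingAt L s R UZ.1.lastStep UZ.2 sj) →
      ChainTouch (img L s sj (T, ZT) :: Us.map (img L s sj)) →
      ∀ Z, Z ⊆ unionL (img L s sj (T, ZT) :: Us.map (img L s sj)) →
        Realises L s R (joinTail T (Us.map Prod.fst) sj) Z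
  | _, _, [], hne, _, _, _, _, _, _, _ => (hne rfl).elim
  | T, ZT, [UZ], _, hT, hTs, hTp, hall, hct, Z, hZ => by
      obtain ⟨hU, hUs, hUp⟩ := hall UZ (by simp)
      have hct' : ChainTouch [img L s sj (T, ZT), img L s sj UZ] := by
        simpa only [List.map_cons, List.map_nil] using hct
      obtain ⟨⟨a, ha, c, hc, hac⟩, -⟩ := (chainTouch_cons_cons _ _ _).1 hct'
      have hc' : c ∈ img L s sj UZ := by simpa using hc
      have hZ' : Z ⊆ img L s sj (T, ZT) ∪ img L s sj UZ := by simpa using hZ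
      show Realises L s R (PGen.join T UZ.1 sj) Z
      exact ⟨ZT, UZ.2, hT, hU, hTs, hUs, hTp, hUp, ⟨a, ha, c, hc', hac⟩, hZ'⟩
  | T, ZT, UZ :: VZ :: Us, _, hT, hTs, hTp, hall, hct, Z, hZ => by
      obtain ⟨hU, hUs, hUp⟩ := hall UZ (by simp)
      have hct' : ChainTouch (img L s sj (T, ZT) :: img L s sj UZ :: (VZ :: Us).map (img L s sj)) := by
        simpa using hct
      obtain ⟨⟨a, ha, c, hc, hac⟩, hrest⟩ := (chainTouch_cons_cons _ _ _).1 hct'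
      -- the rest of the chain, realised by the union of its images
      set ZJ : Finset (Pt d) := unionL (img L s sj UZ :: (VZ :: Us).map (img L s sj)) with hZJ
      have hJ : Realises L s R (joinTail UZ.1 ((VZ :: Us).map Prod.fst) sj) ZJ :=
        realises_joinTail sj UZ.1 UZ.2 (VZ :: Us) (by simp) hU hUs hUp
          (fun W hW => hall W (by simp only [List.mem_cons] at hW ⊢; exact Or.inr hW)) (by simpa using hrest)
          ZJ subset_rfl
      have hlast : (joinTail UZ.1 ((VZ :: Us).map Prod.fst) sj).lastStep = sj := by
        simp [lastStep]
      show Realises L s R (PGen.join T (joinTail UZ.1 (VZ.1 :: Us.map Prod.fst) sj) sj) Z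
      have hmap : (VZ :: Us).map Prod.fst = VZ.1 :: Us.map Prod.fst := rfl
      rw [← hmap]
      refine ⟨ZT, ZJ, hT, hJ, hTs, hlast.le, hTp, ?_, ⟨a, ha, c, ?_, hac⟩, ?_⟩
      · rw [hlast]; exact pendingAt_self L s R sj ZJ
      · rw [hlast, Nat.sub_self, orbit_zero]
        simpa [hZJ] using hc
      · rw [hlast, Nat.sub_self, orbit_zero]
        intro x hx
        have hx' := hZ hx
        simp only [unionL_cons, List.map_cons, Finset.mem_union] at hx' ⊢
        simpa [img, hZJ, or_assoc] using hx'

/-- **PRINT'S TRICHOTOMY, JOIN BRANCH, REALISED**: for at least two constituents (listed with their domains), the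
assembled genealogy at step `sj` is the join chain, realised by any domain inside the union of the images, and its
last step is `sj`. [folklore] -/
theorem realises_assemble_of_two_le (c : Lab d) (sj h : ℕ) (r : Bool) (Ps : List (PGen (Lab d) × Finset (Pt d)))
    (h2 : 2 ≤ Ps.length)
    (hall : ∀ UZ ∈ Ps, Realises L s R UZ.1 UZ.2 ∧ UZ.1.lastStep ≤ sj ∧ PendingAt L s R UZ.1.lastStep UZ.2 sj)
    (hct : ChainTouch (Ps.map (img L s sj))) {Z : Finset (Pt d)} (hZ : Z ⊆ unionL (Ps.map (img L s sj))) :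
    Realises L s R (assemble c sj h (Ps.map Prod.fst) r) Z ∧ (assemble c sj h (Ps.map Prod.fst) r).lastStep = sj := by
  match Ps, h2, hall, hct, hZ with
  | [], h2, _, _, _ => simp at h2
  | [_], h2, _, _, _ => simp at h2
  | TZ :: UZ :: Us, _, hall, hct, hZ =>
      obtain ⟨hT, hTs, hTp⟩ := hall TZ (by simp)
      simp only [List.map_cons, assemble_cons_cons]
      refine ⟨?_, rfl⟩
      have hmap : UZ.1 :: Us.map Prod.fst = (UZ :: Us).map Prod.fst := rfl
      rw [hmap]
      exact realises_joinTail sj TZ.1 TZ.2 (UZ :: Us) (by simp) hT hTs hTp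
        (fun W hW => hall W (by simp only [List.mem_cons] at hW ⊢; exact Or.inr hW)) (by simpa using hct) Z
        (by simpa using hZ)

end JoinChain

/-! ## §1b Two helpers on orbits and sum-typed lists (used by the sibling) -/

/-- one more step of an orbit read at an absolute level: from `t ≤ j`, the image at `j + 1` is ONE S-operation (ratio
of level `j`) of the image at `j` [folklore] -/
theorem orbit_level_succ (L : ℕ) (s : ℕ → ℕ) {t j : ℕ} (ht : t ≤ j) (Z : Finset (Pt d)) :
    orbit L s t Z (j + 1 - t) = Sop (ratio L s j) (orbit L s t Z (j - t)) := by
  rw [show j + 1 - t = (j - t) + 1 by omega, orbit_succ, B16MergeHorizon.ratio_shift, show t + (j - t) = j by omega]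

/-- a list with no left entry maps through `Sum.elim f g` as its right projection through `g` [folklore] -/
theorem map_sum_elim_of_lefts_eq_nil {α β δ : Type*} (f : α → δ) (g : β → δ) :
    ∀ l : List (α ⊕ β), lefts l = [] → l.map (Sum.elim f g) = (rights l).map g
  | [], _ => rfl
  | Sum.inl a :: l, h => by simp at h
  | Sum.inr b :: l, h => by
      simp only [lefts_cons_inr] at h
      simp [map_sum_elim_of_lefts_eq_nil f g l h]

/-- members of a list with no left entry are right entries [folklore] -/
theorem exists_inr_of_lefts_eq_nil {α β : Type*} :
    ∀ {l : List (α ⊕ β)}, lefts l = [] → ∀ x ∈ l, ∃ b, x = Sum.inr b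
  | [], _, x, hx => by simp at hx
  | Sum.inl a :: l, h, _, _ => by simp at h
  | Sum.inr b :: l, h, x, hx => by
      simp only [lefts_cons_inr] at h
      rcases List.mem_cons.1 hx with rfl | hx
      · exact ⟨b, rfl⟩
      · exact exists_inr_of_lefts_eq_nil h x hx

/-! ## §1c Sanity (`ℤ¹`, one-line): two touching unit regions born at step `0`, joined at step `0` -/

namespace Sanity

open B16MergeGeometry.OneDim

/-- a unit region `{z}` anchored at itself, class `0`, born at step `j`, is realised by itself [folklore] -/
theorem realises_unit (L : ℕ) (s R : ℕ → ℕ) (j : ℕ) (z : Pt 1) :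
    Realises L s R (PGen.birth j 0 (z, ({z} : Finset (Pt 1)))) {z} :=
  ⟨rfl, mem_singleton_self _,
    fun x hx y hy => by rw [mem_singleton] at hx hy; subst hx; subst hy; exact Relation.ReflTransGen.refl,
    by rw [treeLen_singleton]; simp⟩

/-- the cubes `0` and `1` of `ℤ¹` touch [folklore] -/
theorem touch_pt0_pt1 : Touch (pt 0) (pt 1) := fun _ => by simp [pt]

/-- hence the join at step `0` of the two unit regions `{0}`, `{1}` (leaf-first list `[{0}, {1}]`) is realised by their
union — an instance of `realises_joinTail` with a one-member tail [folklore] -/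
example (L : ℕ) (s R : ℕ → ℕ) :
    Realises L s R (PGen.join (PGen.birth 0 0 (pt 0, {pt 0})) (PGen.birth 0 0 (pt 1, {pt 1})) 0)
      ({pt 0, pt 1} : Finset (Pt 1)) := by
  have h := realises_joinTail (L := L) (s := s) (R := R) 0 (PGen.birth 0 0 (pt 0, {pt 0})) {pt 0}
    [(PGen.birth 0 0 (pt 1, {pt 1}), {pt 1})] (by simp) (realises_unit L s R 0 (pt 0)) le_rfl
    (pendingAt_self L s R 0 _)
    (fun UZ hUZ => by
      simp only [List.mem_singleton] at hUZ
      subst hUZ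
      exact ⟨realises_unit L s R 0 (pt 1), le_rfl, pendingAt_self L s R 0 _⟩)
    (by
      refine ⟨⟨pt 0, by simp [img, PGen.lastStep], pt 1, by simp [img, PGen.lastStep], touch_pt0_pt1⟩, ?_⟩
      simp)
    {pt 0, pt 1} (by intro x hx; simpa [img, PGen.lastStep, mem_unionL] using hx)
  simpa using h

end Sanity

end

end Summit.QuantumFields.BalabanUV.T4Continuum.HistoryGenealogyRealise
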